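import Literature.NumberTheory.EllipticCurves.HeegnerPointReflectionProofs
import Literature.NumberTheory.EllipticCurves.HuShuYin2019.SylvesterCMPointsConductorNineP
import HarnessLib

/-!
# (W2-b) `stub_levelFixingSeven` — ORBIT FORMS on the class `p ≡ 25 (mod 27)`: the Fricke partner of
# Hu–Shu–Yin's level-`243` form of conductor `9pn` is a level-`243` Heegner form with the SAME residue, and
# its CM point is `w₂₄₃ • τ_n` (crux `UpperOffV0HSYPlus`, stmt-BirchSwinnertonDyer-19804; route `SylvesterTwoHeegnerIndex`)

Cell `bsd-cm`, seat `bsd-cm-k7t-c2` g32 (the (W2-b) seat of record, planner D815/D816).  Helper toward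
`stmt-BirchSwinnertonDyer-19804` (`--supports … --as helper`).  THEOREMS ONLY (no definition, no named fact, no instance,
no `sorry`); vocabulary of `HeegnerPoints.lean` (`heegnerForms`, `heegnerTau`), `HeegnerPointReflectionProofs.lean`
(`HeegnerForm.fricke N Q = (CN, −B, A/N)`, `HeegnerForm.heegnerTau_fricke`), `HuShuYin2019/SylvesterCMPointsConductorNineP`
(`sylvesterForm_mem_heegnerForms`: HSY's form `Q_n = (n²A, nB, C)`, `(A, B, C) = (81(p²+4p+16), −9(4p²+17p+72), 4p²+18p+81)`,
of discriminant `(9pn)²·(−3)` is a level-`243` Heegner form).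

CONTEXT (seat memo `W2B-RECIPROCITY-k7t-c2-g32.md` v2 §4.4, evidence #53 on the crux item; crux idea
`Cruxes/UpperOffV0HSYPlus/Ideas/s3-fibre-transport-w2b.md`, Prop `OrbitForms`; kernel certificate
`SylvesterTwoLevelFixingCert.levelCert_twentyFive`, p748342).  For `p ≡ 25 (mod 27)` (one of the three classes of `p ≡ 7
(mod 9)` modulo `27`) the decomposition involution `s` at `w = (√−3)` carries HSY's CM point `x(τ_n) ∈ X₀(3⁵)` of conductor
`9pn` to `Φ(W)·x(τ_n)`, `W = w₂₄₃` the Fricke involution, at EVERY Kolyvagin level `n` (`9ρ_n(√−3) ∈ V₃·W`,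
`levelCert_twentyFive`).  The point `w₂₄₃ • τ_n` is the CM point of the FRICKE PARTNER `fricke 243 Q_n = (243·C, −nB, n²A/243)`.
Both name-free routes of the memo ((4.1) via B-I `exists_ringEquiv_levelTransport_of_residue_congr_bezout`, (4.2) via the
engine `levelTransport_of_transport_lattice_eq_bezout`) and route (R1) need exactly the following three facts about that partner,
which the tree's `HeegnerForm.fricke_mem_heegnerForms` does NOT supply (its hypothesis «no prime factor of `N` divides `D`» fails:
`3 ∣ D = −243(pn)²`):

* `three_not_dvd_sylvesterA_div` — `A/243 = n²(p²+4p+16)/3` is prime to `3` (`3 ∤ n`, `(p²+4p+16)/3 ≡ 1 (mod 3)`);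
* ★ `fricke_sylvesterForm_mem_heegnerForms` — **`fricke 243 Q_n ∈ heegnerForms 243 ((9pn)²·(−3))`** for `p ≡ 1 (mod 3)`,
  `3 ∤ n`, `gcd(n, C) = 1` (primitivity: a common prime divisor `q` of `(243C, nB, A/243)` is `≠ 3` because `3 ∤ A/243`, hence
  divides `C`, `nB`, `A` — impossible by the primitivity of `Q_n`);
* ★ `fricke_sylvesterForm_residue` — **the partner has the SAME residue: `−nB ≡ nB (mod 486)`, for `p ≡ 25 (mod 27)`**
  (`243 ∣ nB ⟺ 27 ∣ 4p²+17p+72 ⟺ p ≡ 25 (mod 27)` — exactly the class on which the reflection is `W` itself);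
* `heegnerTau_fricke_sylvesterForm` — `heegnerTau (fricke 243 Q_n) = w₂₄₃ • heegnerTau Q_n` (the tree's `heegnerTau_fricke`);
* ★ `orbitForm_W_sylvesterTower` — assembled under the stub's binders (`p % 9 = 7`, `p % 27 = 25`, `n ≠ 0`, every
  prime factor of `n` is `≡ 2 (mod 3)`): `∃ Q′ ∈ heegnerForms 243 ((9pn)²·(−3))` with `Q′.2.1 ≡ (Q_n).2.1 [ZMOD 2·243]` and
  `heegnerTau Q′ = glCast (frickeGL 243) • heegnerTau Q_n` — the `OrbitForms` datum of the idea card / the `(hQ₂, hβ₂)` input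
  of B-I on this class.

NOT HERE: the classes `p ≡ 7, 16 (mod 27)` (partners `A^{±1}W·τ_n`, memo §4.4: primitive form = raw transform / 243 — a
sequel); the class identity `[fricke 243 Q_n] = [Q_n]·[𝔫ₙ]`, `[𝔫ₙ] = η*` (Gross's `w_N`-formula in `classOf'` currency — a
sequel); (G2), (G3); anything about Galois groups.  HONEST LABEL: no stub closed; nothing asserted on 19804; X12.CMAtTwo NOT
proved; BSD is proved for no curve.

## References
* Y. Hu, J. Shu, H. Yin, *An explicit Gross–Zagier formula related to the Sylvester conjecture*, Trans. AMS 372 (2019) =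
  arXiv:1708.05266, §2.1 (`W`), §4.1 p. 10 (the CM point `τ`, `P₁ = [τ, 1]`). [HuShuYin2019]
* B. H. Gross, *Heegner points on `X₀(N)`* (1984), §I.1, §5 (`w_N` on Heegner points). [Gross1984]
* Tree: `HeegnerForm.fricke`, `disc_fricke`, `heegnerTau_fricke`, `pos_snd_snd` (`HeegnerPointReflectionProofs`);
  `sylvesterForm_mem_heegnerForms`, `dvd_A`, `three_not_dvd_C`, `isCoprime_C_of_forall_prime_mod_three_eq_two`
  (`HuShuYin2019/SylvesterCMPointsConductorNineP`).  `lean search 'fricke.*sylvester|sylvester.*fricke'` → nothing before this file.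
-/

set_option autoImplicit false
-- the Summit-side namespace `Summit.BirchSwinnertonDyer.BirchSwinnertonDyer.…` (summit = problem) is mandated by D-0017
set_option linter.dupNamespace false

noncomputable section

namespace Summit.BirchSwinnertonDyer.BirchSwinnertonDyer.Theorems.SylvesterTwoLevelFixingOrbit

open Literature.NumberTheory.EllipticCurves Literature.NumberTheory.EllipticCurves.HeegnerForm
  Literature.NumberTheory.EllipticCurves.HuShuYin2019 Literature.NumberTheory.EllipticCurves.ModularForms

/-! ## §1 `A/243 = n²(p²+4p+16)/3` is prime to `3` -/

/-- `p ≡ 1 (mod 3)` as `p = 3k + 1` (private helper). [folklore] -/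
private theorem exists_eq_three_mul_add_one' {p : ℕ} (hp : p % 3 = 1) : ∃ k : ℕ, p = 3 * k + 1 :=
  ⟨p / 3, by omega⟩

/-- **`A/243 = n²·(p²+4p+16)/3`** for HSY's `A = 81(p²+4p+16)`, `p ≡ 1 (mod 3)` (so `3 ∣ p²+4p+16`), as an exact integer
division. [cite: HuShuYin2019, §4.1 (p. 10: the point τ, 243 ∣ A)] -/
theorem sylvesterA_div_eq {p : ℕ} (hp : p % 3 = 1) (n : ℤ) :
    n ^ 2 * (81 * ((p : ℤ) ^ 2 + 4 * p + 16)) / 243 = n ^ 2 * (((p : ℤ) ^ 2 + 4 * p + 16) / 3) ∧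
    (3 : ℤ) * (((p : ℤ) ^ 2 + 4 * p + 16) / 3) = (p : ℤ) ^ 2 + 4 * p + 16 := by
  obtain ⟨k, rfl⟩ := exists_eq_three_mul_add_one' hp
  have h3 : ((3 * k + 1 : ℕ) : ℤ) ^ 2 + 4 * ((3 * k + 1 : ℕ) : ℤ) + 16 = 3 * (3 * (k : ℤ) ^ 2 + 6 * k + 7) := by
    push_cast; ring
  rw [h3, Int.mul_ediv_cancel_left _ (by norm_num : (3 : ℤ) ≠ 0)]
  refine ⟨?_, rfl⟩
  rw [show n ^ 2 * (81 * (3 * (3 * (k : ℤ) ^ 2 + 6 * k + 7))) = 243 * (n ^ 2 * (3 * (k : ℤ) ^ 2 + 6 * k + 7)) by ring,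
    Int.mul_ediv_cancel_left _ (by norm_num : (243 : ℤ) ≠ 0)]

/-- **`3 ∤ A/243`**: for `p ≡ 1 (mod 3)` and `3 ∤ n`, `3` does not divide `n²(81(p²+4p+16))/243 = n²(p²+4p+16)/3`
(`(p²+4p+16)/3 = 3k²+6k+7 ≡ 1 (mod 3)` for `p = 3k+1`).  This replaces the hypothesis «no prime factor of `N` divides `D`» of
`HeegnerForm.fricke_mem_heegnerForms`, which fails here (`3 ∣ D`). [cite: HuShuYin2019, §4.1 (p. 10)] -/
theorem three_not_dvd_sylvesterA_div {p n : ℕ} (hp : p % 3 = 1) (hn3 : ¬ 3 ∣ n) :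
    ¬ (3 : ℤ) ∣ (n : ℤ) ^ 2 * (81 * ((p : ℤ) ^ 2 + 4 * p + 16)) / 243 := by
  obtain ⟨k, rfl⟩ := exists_eq_three_mul_add_one' hp
  have h : ((n : ℤ)) ^ 2 * (81 * (((3 * k + 1 : ℕ) : ℤ) ^ 2 + 4 * ((3 * k + 1 : ℕ) : ℤ) + 16)) / 243 =
      (n : ℤ) ^ 2 * (3 * (k : ℤ) ^ 2 + 6 * k + 7) := by
    rw [show ((n : ℤ)) ^ 2 * (81 * (((3 * k + 1 : ℕ) : ℤ) ^ 2 + 4 * ((3 * k + 1 : ℕ) : ℤ) + 16)) =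
        243 * ((n : ℤ) ^ 2 * (3 * (k : ℤ) ^ 2 + 6 * k + 7)) by push_cast; ring,
      Int.mul_ediv_cancel_left _ (by norm_num : (243 : ℤ) ≠ 0)]
  rw [h]
  intro hdvd
  rcases Int.prime_three.dvd_or_dvd hdvd with h1 | h1
  · have : (3 : ℤ) ∣ (n : ℤ) := Int.prime_three.dvd_of_dvd_pow h1
    exact hn3 (by exact_mod_cast this)
  · obtain ⟨m, hm⟩ := h1
    have hk : (3 : ℤ) ∣ 3 * (k : ℤ) ^ 2 + 6 * k := ⟨(k : ℤ) ^ 2 + 2 * k, by ring⟩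
    omega

/-! ## §2 The Fricke partner is a level-`243` Heegner form of the same discriminant -/

/-- ★ **The Fricke partner `fricke 243 Q_n = (243·C, −nB, n²A/243)` of Hu–Shu–Yin's form of conductor `9pn` is a level-`243`
Heegner form of discriminant `(9pn)²·(−3)`**, for `p ≡ 1 (mod 3)`, `n ≥ 1`, `3 ∤ n`, `gcd(n, C) = 1`: discriminant by
`disc_fricke`, `243C > 0`, `243 ∣ 243C`; primitivity — a common prime divisor `q` of `243C`, `nB`, `A/243` is not `3`
(`three_not_dvd_sylvesterA_div`), so `q ∣ C` and `q ∣ A`, contradicting the primitivity of `Q_n`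
(`sylvesterForm_mem_heegnerForms`).  Its CM point is `w₂₄₃ • τ_n` (`heegnerTau_fricke_sylvesterForm`).
[cite: HuShuYin2019, §2.1 (W), §4.1 (p. 10)] [cite: Gross1984, §I.1, §5] -/
theorem fricke_sylvesterForm_mem_heegnerForms {p n : ℕ} (hp : p % 3 = 1) (hn : n ≠ 0) (hn3 : ¬ 3 ∣ n)
    (hnC : IsCoprime (n : ℤ) (4 * (p : ℤ) ^ 2 + 18 * p + 81)) :
    fricke 243 ((n : ℤ) ^ 2 * (81 * ((p : ℤ) ^ 2 + 4 * p + 16)), (n : ℤ) * (-(9 * (4 * (p : ℤ) ^ 2 + 17 * p + 72))),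
        4 * (p : ℤ) ^ 2 + 18 * p + 81) ∈
      heegnerForms 243 (((9 * p * n : ℕ) : ℤ) ^ 2 * (-3)) := by
  have hQ := sylvesterForm_mem_heegnerForms hp hn hnC
  obtain ⟨hdisc, hA, hNA, hprim⟩ := hQ
  have hD0 : ((9 * p * n : ℕ) : ℤ) ^ 2 * (-3) < 0 := by
    have h9 : (0 : ℤ) < ((9 * p * n : ℕ) : ℤ) := by
      have hp0 : 0 < p := by omega
      exact_mod_cast Nat.mul_pos (Nat.mul_pos (by norm_num) hp0) (Nat.pos_of_ne_zero hn)
    nlinarith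
  have hC : 0 < (4 * (p : ℤ) ^ 2 + 18 * p + 81) := by positivity
  refine ⟨by rw [disc_fricke hNA, hdisc], ?_, ?_, ?_⟩
  · simp only [fricke_fst]
    exact mul_pos hC (by norm_num)
  · simp only [fricke_fst]
    exact Dvd.intro_left _ rfl
  · intro d hd₁ hd₂ hd₃
    simp only [fricke_fst, fricke_snd_fst, fricke_snd_snd, dvd_neg] at hd₁ hd₂ hd₃
    by_contra hd
    obtain ⟨q, hq, hqd⟩ := Int.exists_prime_and_dvd (fun h ↦ hd (Int.isUnit_iff_natAbs_eq.mpr h))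
    -- `q ≠ ±3` since `3 ∤ A/243`
    have hq3 : ¬ (q ∣ 3) := by
      intro h
      have hassoc : Associated q 3 := hq.associated_of_dvd Int.prime_three h
      exact three_not_dvd_sylvesterA_div hp hn3 (hassoc.symm.dvd.trans (hqd.trans hd₃))
    -- hence `q ∣ C`
    have hqC : q ∣ 4 * (p : ℤ) ^ 2 + 18 * p + 81 := by
      have h1 : q ∣ (4 * (p : ℤ) ^ 2 + 18 * p + 81) * 243 := hqd.trans hd₁
      rcases hq.dvd_or_dvd h1 with h | h
      · exact h
      · have h' : q ∣ (3 : ℤ) ^ 5 := by norm_num; exact h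
        exact absurd (hq.dvd_of_dvd_pow h') hq3
    -- and `q ∣ A`, `q ∣ nB`
    have hNA' : (243 : ℤ) ∣ (n : ℤ) ^ 2 * (81 * ((p : ℤ) ^ 2 + 4 * p + 16)) := hNA
    have hqA : q ∣ (n : ℤ) ^ 2 * (81 * ((p : ℤ) ^ 2 + 4 * p + 16)) := by
      have h := hqd.trans hd₃
      rw [← Int.ediv_mul_cancel hNA']
      exact Dvd.dvd.mul_right h 243
    have hqB : q ∣ (n : ℤ) * (-(9 * (4 * (p : ℤ) ^ 2 + 17 * p + 72))) := hqd.trans hd₂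
    have hu := hprim q hqA hqB hqC
    exact hq.not_unit hu

/-! ## §3 Same residue on the class `p ≡ 25 (mod 27)`, and the CM point -/

/-- ★ **The Fricke partner has the SAME residue `β ≡ nB (mod 2·243)` on the class `p ≡ 25 (mod 27)`**: `−nB ≡ nB (mod 486)`,
i.e. `243 ∣ nB = −9n(4p²+17p+72)`, because `27 ∣ 4p²+17p+72` exactly when `p ≡ 25 (mod 27)` (`p = 27s + 25`:
`4p²+17p+72 = 27(108s²+217s+111)`).  This is WHY the reflection of the kernel certificate is `W` itself on this class
(`SylvesterTwoLevelFixingCert.levelCert_twentyFive`) and why B-I / the engine (both need equal residues) apply to the pair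
`(Q_n, fricke 243 Q_n)` here. [cite: HuShuYin2019, §2.2 (Thm 2.2: the case split of p mod 27)] -/
theorem fricke_sylvesterForm_residue {p : ℕ} (hp : p % 27 = 25) (n : ℤ) :
    (fricke 243 (n ^ 2 * (81 * ((p : ℤ) ^ 2 + 4 * p + 16)), n * (-(9 * (4 * (p : ℤ) ^ 2 + 17 * p + 72))),
        4 * (p : ℤ) ^ 2 + 18 * p + 81)).2.1 ≡
      n * (-(9 * (4 * (p : ℤ) ^ 2 + 17 * p + 72))) [ZMOD 2 * 243] := by
  obtain ⟨s, rfl⟩ : ∃ s : ℕ, p = 27 * s + 25 := ⟨p / 27, by omega⟩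
  simp only [fricke_snd_fst]
  refine Int.ModEq.symm ((Int.modEq_iff_dvd).mpr ?_)
  refine ⟨n * (108 * (s : ℤ) ^ 2 + 217 * s + 111), ?_⟩
  push_cast
  ring

/-- **`heegnerTau (fricke 243 Q_n) = w₂₄₃ • heegnerTau Q_n`** (the tree's `HeegnerForm.heegnerTau_fricke`, whose hypotheses
`A > 0`, `disc < 0`, `243 ∣ A` hold for HSY's form, `p ≥ 1`, `n ≥ 1`). [cite: Gross1984, §5 (w_N on CM points)]
[cite: HuShuYin2019, §2.1 (W)] -/
theorem heegnerTau_fricke_sylvesterForm {p n : ℕ} (hp : p % 3 = 1) (hn : n ≠ 0) :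
    heegnerTau (fricke 243 ((n : ℤ) ^ 2 * (81 * ((p : ℤ) ^ 2 + 4 * p + 16)),
        (n : ℤ) * (-(9 * (4 * (p : ℤ) ^ 2 + 17 * p + 72))), 4 * (p : ℤ) ^ 2 + 18 * p + 81)) =
      glCast (frickeGL 243 : GL (Fin 2) ℚ) •
        heegnerTau ((n : ℤ) ^ 2 * (81 * ((p : ℤ) ^ 2 + 4 * p + 16)),
          (n : ℤ) * (-(9 * (4 * (p : ℤ) ^ 2 + 17 * p + 72))), 4 * (p : ℤ) ^ 2 + 18 * p + 81) := by
  have hn0 : (0 : ℤ) < n := by exact_mod_cast Nat.pos_of_ne_zero hn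
  have hA : (0 : ℤ) < (n : ℤ) ^ 2 * (81 * ((p : ℤ) ^ 2 + 4 * p + 16)) := by positivity
  have hdisc : ((n : ℤ) * (-(9 * (4 * (p : ℤ) ^ 2 + 17 * p + 72)))) ^ 2 -
      4 * ((n : ℤ) ^ 2 * (81 * ((p : ℤ) ^ 2 + 4 * p + 16))) * (4 * (p : ℤ) ^ 2 + 18 * p + 81) < 0 := by
    have h : ((n : ℤ) * (-(9 * (4 * (p : ℤ) ^ 2 + 17 * p + 72)))) ^ 2 -
        4 * ((n : ℤ) ^ 2 * (81 * ((p : ℤ) ^ 2 + 4 * p + 16))) * (4 * (p : ℤ) ^ 2 + 18 * p + 81) =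
        -(243 * ((p : ℤ) * n) ^ 2) := by ring
    rw [h]
    have hp0 : (0 : ℤ) < p := by exact_mod_cast (show 0 < p by omega)
    nlinarith [mul_pos hp0 hn0]
  exact heegnerTau_fricke (N := 243) hA hdisc (dvd_A hp n)

/-! ## §4 Assembly: the `OrbitForms` datum on the class `p ≡ 25 (mod 27)` -/

/-- ★ **ORBIT FORMS on the W-class.**  Under the binders of `stub_levelFixingSeven` restricted to `p ≡ 25 (mod 27)` —
`p ≡ 7 (mod 9)` (primality of `p` is not needed), `n ≠ 0`, every prime factor of `n` is `≡ 2 (mod 3)` — the CM point `w₂₄₃ • τ_n` (to which the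
decomposition involution at `w = (√−3)` carries HSY's `x(τ_n)`, `levelCert_twentyFive` + HSY Thm 2.3) is the Heegner point of
a level-`243` Heegner form `Q′` of the SAME discriminant `(9pn)²·(−3)` and the SAME residue as `Q_n` modulo `2·243` —
namely `Q′ = fricke 243 Q_n`.  This is the `(hQ₂, hβ₂)` input of B-I `exists_ringEquiv_levelTransport_of_residue_congr_bezout`
and the `OrbitForms` conjunct of idea `s3-fibre-transport-w2b` on this class.  No Galois statement is made.
[cite: HuShuYin2019, §2.1–2.2, §4.1] [cite: Gross1984, §I.1, §5] -/
theorem orbitForm_W_sylvesterTower {p : ℕ} (h9 : p % 9 = 7) (h27 : p % 27 = 25)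
    {n : ℕ} (hn : n ≠ 0) (hprimes : ∀ q ∈ n.primeFactors, q % 3 = 2) :
    ∃ Q' ∈ heegnerForms 243 (((9 * p * n : ℕ) : ℤ) ^ 2 * (-3)),
      Q'.2.1 ≡ (n : ℤ) * (-(9 * (4 * (p : ℤ) ^ 2 + 17 * p + 72))) [ZMOD 2 * 243] ∧
      heegnerTau Q' = glCast (frickeGL 243 : GL (Fin 2) ℚ) •
        heegnerTau ((n : ℤ) ^ 2 * (81 * ((p : ℤ) ^ 2 + 4 * p + 16)),
          (n : ℤ) * (-(9 * (4 * (p : ℤ) ^ 2 + 17 * p + 72))), 4 * (p : ℤ) ^ 2 + 18 * p + 81) := by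
  have hp3 : p % 3 = 1 := by omega
  have hn3 : ¬ 3 ∣ n := by
    intro h
    have h3 := hprimes 3 (Nat.mem_primeFactors.mpr ⟨Nat.prime_three, h, hn⟩)
    omega
  have hnC := isCoprime_C_of_forall_prime_mod_three_eq_two (p := p) hn hprimes
  exact ⟨_, fricke_sylvesterForm_mem_heegnerForms hp3 hn hn3 hnC, fricke_sylvesterForm_residue h27 n,
    heegnerTau_fricke_sylvesterForm hp3 hn⟩

end Summit.BirchSwinnertonDyer.BirchSwinnertonDyer.Theorems.SylvesterTwoLevelFixingOrbit

end
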